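import Literature.AlgebraicGeometry.HodgeTheory.ProjectiveBundleOfGloballyGeneratedQuotient
import Literature.AlgebraicGeometry.HodgeTheory.FlagBundleSplittingOfProjectiveBundle
import HarnessLib

/-!
# The projective-bundle step of the splitting construction from its globally generated case (corollary)

Family `hodge`, layer `Literature/AlgebraicGeometry/HodgeTheory`. THEOREMS ONLY (no definition, no instance, no
notation, no named fact, no `sorry`).

`ProjectiveBundleOfGloballyGeneratedQuotient ⟹ ProjectiveBundleTautologicalQuotient`: the named fact of
`HodgeTheory/ProjectiveBundleOfGloballyGeneratedQuotient` (Hartshorne II Prop. 7.10–7.12 for a globally generated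
vector bundle) fed into the PROVED reduction `projectiveBundleTautologicalQuotient_of_forall_globallyGenerated`
(`HodgeTheory/ProjectiveBundleTautologicalQuotientReduction`: constant rank on the irreducible `X`, Serre's theorem
A, `𝐏(ℰ) ≅ 𝐏(ℰ ⊗ ℒ)`), and on into the tree's splitting chain: `flagBundleSplitting_of_globallyGenerated`
(`HodgeTheory/FlagBundleSplittingOfProjectiveBundle.flagBundleSplitting_of_projectiveBundleTautologicalQuotient`).
HONEST LEDGER: both sides are hypotheses until the incidence construction `P(G) = V(u) ↪ X × Gr₁(ℤ^J)` lands;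
nothing here bears on any case of the Hodge conjecture.

## References

* [Hartshorne1977] R. Hartshorne, *Algebraic Geometry* (1977), II §7 Lemma 7.9, Prop. 7.10–7.12; II Thm. 5.17.
* [Fulton1998] W. Fulton, *Intersection Theory*, 2nd ed. (1998), §3.2 (splitting construction).
-/

noncomputable section

namespace Literature.AlgebraicGeometry.HodgeTheory

/-- **The projective-bundle step for every vector bundle from the step for globally generated ones**
(`ProjectiveBundleOfGloballyGeneratedQuotient ⟹ ProjectiveBundleTautologicalQuotient`; the proved reduction
`projectiveBundleTautologicalQuotient_of_forall_globallyGenerated`: constant rank, Serre's theorem A, and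
`𝐏(ℰ) ≅ 𝐏(ℰ ⊗ ℒ)`). [cite: Hartshorne1977, II §7 Lemma 7.9 (b), Prop. 7.11; II Thm. 5.17] -/
theorem projectiveBundleTautologicalQuotient_of_globallyGenerated
    (h : ProjectiveBundleOfGloballyGeneratedQuotient) : ProjectiveBundleTautologicalQuotient :=
  projectiveBundleTautologicalQuotient_of_forall_globallyGenerated h

/-- **The flag-bundle splitting (`FlagBundleSplitting`) from the projective bundle of a globally generated
bundle** (the tower of `HodgeTheory/FlagBundleSplittingOfProjectiveBundle` on top of the corollary above).
[cite: Fulton1998, §3.2 (splitting construction)] [cite: Hartshorne1977, II §7 Prop. 7.11] -/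
theorem flagBundleSplitting_of_globallyGenerated (h : ProjectiveBundleOfGloballyGeneratedQuotient) :
    FlagBundleSplitting :=
  flagBundleSplitting_of_projectiveBundleTautologicalQuotient
    (projectiveBundleTautologicalQuotient_of_globallyGenerated h)



end Literature.AlgebraicGeometry.HodgeTheory

end
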